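import Summits.QuantumFields.BalabanUV.Gaps.SecondMomentTruncation
import Literature.MathematicalPhysics.QuantumFieldTheory.Balaban1983to89.Beta.RemainderConstNumerals

/-!
# `BalabanUV.Gaps.SecondMomentTruncationClosed` — cell pub-balaban-gaps, row (D1): THE TRUNCATION TAIL OF `Gaps.SecondMomentTruncation` IN CLOSED FORM
# (no infinite sum left) AND THE ENGINE's RADIUS RULE — sibling of `Gaps/SecondMomentTruncation.lean` (p364832 ✓), composing its §2 with the β sub-cell's
# closed forms `Beta.RemainderConstNumerals.betaPrime510_le_elem` ∕ `betaPrime510_four_eq_closed` at rate `δ₁∕2` (BY NAME; nothing re-proved)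

WHY A SIBLING AND NOT AN APPEND (located): the v1.1 append of `Gaps/SecondMomentTruncation` bounced at the gate's append-only check on the auxiliary
equation lemma `B12Sec2to5.betaPrime510.eq_1`, which v1's module happens to generate and which the new import (`RemainderConstNumerals`, unfolding
`betaPrime510` itself) would supply instead — a re-import artefact, no mathematical content; a sibling file has no such constraint.

HONEST FRAMING (cell contract, verbatim): «discharging `BetaPertH` makes Bałaban's UV stability UNCONDITIONAL — a real constructive-QFT result;
it is NOT the continuum limit and NOT the Clay problem.»  HONEST DEPENDENCY (verbatim): «continuum YM on T⁴ ⇐ BetaPertH ∧ nine spine estimates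
(0/9 proved); BetaPertH ⇐ (D1) ∧ (D4) ∧ CAP+tail; G-an2-4 gates asym, D1 and NE2/3/4.»  THIS MODULE DISCHARGES NOTHING: [folklore] composition of
tree theorems for an ARBITRARY `Decay510` kernel; no number enters (`C, δ₁` are a supplier's — `OneStepKernelFamily.hdec_TOf` gives them existentially
only); nothing of Bałaban's asserted; (D1) NOT discharged; 0∕4 row-D1 binders; NOT BetaPertH, NOT continuum, NOT Clay.  No `def`, no `def … : Prop`,
nothing cited, 0 sorry.

CONTENT (hypotheses of `SecondMomentTruncation.abs_secondMoment_sub_sum_le_of_decay510` verbatim: `0 < δ₁`, `Decay510 (P μ ν) C δ₁`, a finite `S`,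
`∀ x ∉ S, R ≤ |x|₁`).  §1 `abs_secondMoment_sub_sum_le_elem` (any `d`): `|secondMoment P μ ν − Σ_{x∈S} P μ ν x·x_μ·x_ν| ≤ e^{−(δ₁∕2)R}·(C·(64∕δ₁²)·(1 + 8∕δ₁)^d)`;
`abs_secondMoment_sub_sum_le_closed_four` (`d = 4`, `q := e^{−δ₁∕2}`): `… ≤ e^{−(δ₁∕2)R}·(C·8q(1+q)²(1+8q+q²)∕(1−q)⁶)` — an EQUALITY for the majorant's
lattice sum, so nothing is lost beyond the parent's §2.  §2 `abs_sub_le_of_exp_mul_le_of_log_le` (real algebra) and the RADIUS RULE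
`abs_secondMoment_sub_sum_le_of_log_le`: `0 < C`, `0 < ε`, `log (C·(64∕δ₁²)(1 + 8∕δ₁)^d ∕ ε) ≤ (δ₁∕2)·R` ⟹ `|secondMoment P μ ν − Σ_S| ≤ ε` — how large the
certified ball must be for a prescribed tolerance.

ABSOLUTE RULE (cell charter, verbatim): «No internally-minted statement may enter as a cited fact. Every hypothesis is either kernel-proved in this
package or a verbatim quotation of a PUBLISHED theorem with page reference. The manuscript(s) under audit are NOT citable for their own disputed
steps — they are the thing under adjudication; programme-internal (2001/route/tribunal) claims are never citable.»

Provenance: cell pub-balaban-gaps, seat g1-p1 GEN 8 (prover-pub-balaban-gaps-g1-p1-g8-0), 2026-08-23; imports `Gaps/SecondMomentTruncation` +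
`Literature/…/Beta/RemainderConstNumerals` ONLY; no existing file touched.
-/

noncomputable section

open Finset
open scoped BigOperators
open Literature.MathematicalPhysics.QuantumFieldTheory.Balaban1983to89
open B12Sec2to5 (l1 Decay510 betaPrime510)
open Summit.QuantumFields.BalabanUV.Gaps.SecondMomentTruncation (decay510_const_nonneg abs_secondMoment_sub_sum_le_of_decay510)

namespace Summit.QuantumFields.BalabanUV.Gaps.SecondMomentTruncationClosed

variable {d : ℕ}

/-! ## §1 The tail in closed form; §2 the engine's radius rule -/

/-- [folklore] **ELEMENTARY CLOSED-FORM TAIL (any `d`)**: under the hypotheses of `abs_secondMoment_sub_sum_le_of_decay510`,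
`|secondMoment P μ ν − Σ_{x∈S} P μ ν x·x_μ·x_ν| ≤ e^{−(δ₁∕2)R} · (C · (64∕δ₁² · (1 + 8∕δ₁)^d))` — `RemainderConstNumerals.betaPrime510_le_elem` at rate `δ₁∕2`. -/
theorem abs_secondMoment_sub_sum_le_elem {P : B12Beta.Kernel d} {C δ₁ : ℝ} {μ ν : Fin d} (hδ : 0 < δ₁)
    (h : Decay510 (P μ ν) C δ₁) (S : Finset (Fin d → ℤ)) {R : ℝ} (hS : ∀ x, x ∉ S → R ≤ l1 x) :
    |B12Beta.secondMoment P μ ν - ∑ x ∈ S, P μ ν x * (x μ : ℝ) * (x ν : ℝ)|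
      ≤ Real.exp (-(δ₁ / 2) * R) * (C * (64 / δ₁ ^ 2 * (1 + 8 / δ₁) ^ d)) := by
  have hC : 0 ≤ C := decay510_const_nonneg h
  have h1 := abs_secondMoment_sub_sum_le_of_decay510 hδ h S hS
  have h2 : betaPrime510 d C (δ₁ / 2) ≤ C * (16 / (δ₁ / 2) ^ 2 * (1 + 4 / (δ₁ / 2)) ^ d) :=
    Beta.RemainderConstNumerals.betaPrime510_le_elem d hC (half_pos hδ)
  have h3 : C * (16 / (δ₁ / 2) ^ 2 * (1 + 4 / (δ₁ / 2)) ^ d) = C * (64 / δ₁ ^ 2 * (1 + 8 / δ₁) ^ d) := by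
    have hδ0 : δ₁ ≠ 0 := hδ.ne'
    congr 1
    rw [show (4 : ℝ) / (δ₁ / 2) = 8 / δ₁ by field_simp; ring]
    congr 1
    field_simp
    ring
  exact h1.trans (mul_le_mul_of_nonneg_left (h2.trans_eq h3) (Real.exp_pos _).le)

/-- [folklore] **EXACT CLOSED-FORM TAIL AT `d = 4`**: with `q := e^{−δ₁∕2}`,
`|secondMoment P μ ν − Σ_{x∈S} P μ ν x·x_μ·x_ν| ≤ e^{−(δ₁∕2)R} · (C · (8q(1+q)²(1+8q+q²)∕(1−q)⁶))` — the majorant's lattice sum summed EXACTLY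
(`RemainderConstNumerals.betaPrime510_four_eq_closed` at rate `δ₁∕2`); this is §2's bound with no infinite sum left. -/
theorem abs_secondMoment_sub_sum_le_closed_four {P : B12Beta.Kernel 4} {C δ₁ : ℝ} {μ ν : Fin 4} (hδ : 0 < δ₁)
    (h : Decay510 (P μ ν) C δ₁) (S : Finset (Fin 4 → ℤ)) {R : ℝ} (hS : ∀ x, x ∉ S → R ≤ l1 x) :
    |B12Beta.secondMoment P μ ν - ∑ x ∈ S, P μ ν x * (x μ : ℝ) * (x ν : ℝ)|
      ≤ Real.exp (-(δ₁ / 2) * R) * (C * (8 * Real.exp (-(δ₁ / 2)) * (1 + Real.exp (-(δ₁ / 2))) ^ 2 *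
          (1 + 8 * Real.exp (-(δ₁ / 2)) + Real.exp (-(δ₁ / 2)) ^ 2) / (1 - Real.exp (-(δ₁ / 2))) ^ 6)) := by
  rw [← Beta.RemainderConstNumerals.betaPrime510_four_eq_closed C (half_pos hδ)]
  exact abs_secondMoment_sub_sum_le_of_decay510 hδ h S hS

/-- [folklore] **THE ENGINE's RADIUS RULE**: if the tail is bounded by `e^{−(δ₁∕2)R}·B` with `0 < B` (either closed form above, or `betaPrime510 d C (δ₁∕2)`
itself when positive) and the ball radius satisfies `log (B∕ε) ≤ (δ₁∕2)·R` for a target `0 < ε`, then `|secondMoment P μ ν − Σ_S| ≤ ε`. -/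
theorem abs_sub_le_of_exp_mul_le_of_log_le {a b B ε δ₁ R : ℝ} (hab : |a - b| ≤ Real.exp (-(δ₁ / 2) * R) * B) (hB : 0 < B) (hε : 0 < ε)
    (hR : Real.log (B / ε) ≤ δ₁ / 2 * R) : |a - b| ≤ ε := by
  refine hab.trans ?_
  have h1 : Real.exp (-(δ₁ / 2) * R) ≤ ε / B := by
    have h2 : Real.exp (-(δ₁ / 2) * R) ≤ Real.exp (-Real.log (B / ε)) := Real.exp_le_exp.mpr (by linarith)
    refine h2.trans (le_of_eq ?_)
    rw [Real.exp_neg, Real.exp_log (div_pos hB hε), inv_div]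
  calc Real.exp (-(δ₁ / 2) * R) * B ≤ ε / B * B := mul_le_mul_of_nonneg_right h1 hB.le
    _ = ε := div_mul_cancel₀ ε hB.ne'

/-- [folklore] **… AT THE ELEMENTARY CONSTANT**: `0 < C`, `0 < δ₁`, `0 < ε`, `log (C·(64∕δ₁²)(1 + 8∕δ₁)^d ∕ ε) ≤ (δ₁∕2)·R`, `S ⊇ {|x|₁ < R}` ⟹
`|secondMoment P μ ν − Σ_{x∈S} P μ ν x·x_μ·x_ν| ≤ ε` — how large the certified ball must be for a prescribed tolerance. -/
theorem abs_secondMoment_sub_sum_le_of_log_le {P : B12Beta.Kernel d} {C δ₁ ε : ℝ} {μ ν : Fin d} (hδ : 0 < δ₁) (hC : 0 < C) (hε : 0 < ε)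
    (h : Decay510 (P μ ν) C δ₁) (S : Finset (Fin d → ℤ)) {R : ℝ} (hS : ∀ x, x ∉ S → R ≤ l1 x)
    (hR : Real.log (C * (64 / δ₁ ^ 2 * (1 + 8 / δ₁) ^ d) / ε) ≤ δ₁ / 2 * R) :
    |B12Beta.secondMoment P μ ν - ∑ x ∈ S, P μ ν x * (x μ : ℝ) * (x ν : ℝ)| ≤ ε :=
  abs_sub_le_of_exp_mul_le_of_log_le (abs_secondMoment_sub_sum_le_elem hδ h S hS) (by positivity) hε hR

end Summit.QuantumFields.BalabanUV.Gaps.SecondMomentTruncationClosed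

end
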